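import Mathlib
import HarnessLib
import Summits.RiemannHypothesis.RiemannHypothesis.Theorems.DeBrangesSuzukiDoorDefs

/-!
# RiemannHypothesis / DeBrangesSuzukiDoor — H1 toolkit: Laplace transforms of windowed kernels

Port (verbatim up to namespace/imports) of the generic part of §"WitnessQuotient" of the rh-dbr scratch module
`SuzukiCanonicalWindow.lean` (sha16 `82bfcc5f80debbaf`, lines 1821–2128; referee read PASS 2026-08-25T19:28Z),
for route `route-RiemannHypothesis-DeBrangesSuzukiDoor`, support item `DoorModuloKernel`
(stmt-RiemannHypothesis-19729). For a real kernel `K` (section variable) that is continuous, vanishes on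
`(-∞,0)` and satisfies `|K(x)| ≤ C e^{cx}`: the unit-window average `u ↦ ∫_0^1 K(u+y) dy` vanishes on
`(-∞,-1]`; the Laplace transform `z ↦ ∫ W(u) e^{izu} du` of any `W ∈ L²(ℝ)` vanishing on `(-∞,-1]` is
holomorphic on `ℂ₊` (`differentiableOn_laplace_of_memLp`, differentiation under the integral sign); the
unit window has the entire Laplace transform `unitLaplace` (`≠ 0` at `z = i`); and Fubini gives
`laplace_window_eq`: `∫ (∫_0^1 K(u+y)dy) e^{izu} du = (∫_0^∞ K(x) e^{izx} dx) · unitLaplace z` on `Im z > c`.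
Pure real/complex analysis; nothing in this file bears on the truth of RH.
-/

noncomputable section

-- D-0017: `Summit.<S>.<S>.…` is the designed namespace of a single-problem summit.
set_option linter.dupNamespace false

open MeasureTheory Complex
open Filter Topology Set

namespace Summit.RiemannHypothesis.RiemannHypothesis.Theorems.SuzukiDoor

open Literature.NumberTheory.LFunctions

variable {K : ℝ → ℝ}

/-- `Re (i z u) = -(Im z) u` for real `u`. -/
lemma re_I_mul_mul_ofReal (z : ℂ) (u : ℝ) : (I * z * (u : ℂ)).re = -(z.im * u) := by
  simp only [Complex.mul_re, Complex.mul_im, Complex.I_re, Complex.I_im, Complex.ofReal_re,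
    Complex.ofReal_im]
  ring

/-- `|e^{izu}| = e^{-(Im z) u}` for real `u`. -/
lemma norm_cexp_I_mul_mul_ofReal (z : ℂ) (u : ℝ) :
    ‖Complex.exp (I * z * (u : ℂ))‖ = Real.exp (-(z.im * u)) := by
  rw [Complex.norm_exp, re_I_mul_mul_ofReal]

/-- A continuous function vanishing on `(-∞,0)` vanishes on `(-∞,0]`. -/
lemma eq_zero_of_nonpos_of_vanishing (hKc : Continuous K) (hK0 : ∀ x : ℝ, x < 0 → K x = 0) {x : ℝ}
    (hx : x ≤ 0) : K x = 0 := by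
  rcases lt_or_eq_of_le hx with h | h
  · exact hK0 x h
  · subst h
    have h1 : Tendsto K (𝓝[<] (0 : ℝ)) (𝓝 (K 0)) := (hKc.tendsto 0).mono_left nhdsWithin_le_nhds
    have h2 : Tendsto K (𝓝[<] (0 : ℝ)) (𝓝 0) := by
      apply tendsto_const_nhds.congr'
      filter_upwards [self_mem_nhdsWithin] with x hx
      exact (hK0 x hx).symm
    exact tendsto_nhds_unique h1 h2

/-- Pointwise bound of the shifted kernel on the unit window. -/
lemma abs_shift_le_of_expBound (hK0 : ∀ x : ℝ, x < 0 → K x = 0) {C c : ℝ} (hc : 0 ≤ c)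
    (hC : ∀ x : ℝ, 0 ≤ x → |K x| ≤ C * Real.exp (c * x)) {u y : ℝ} (hy : y ∈ Ioo (0 : ℝ) 1) :
    |K (u + y)| ≤ C * Real.exp c * Real.exp (c * u) := by
  have hC0 : 0 ≤ C := by
    have := hC 0 le_rfl
    simp at this
    exact (abs_nonneg _).trans this
  rcases lt_or_ge (u + y) 0 with h | h
  · rw [hK0 _ h, abs_zero]; positivity
  · calc |K (u + y)| ≤ C * Real.exp (c * (u + y)) := hC _ h
      _ ≤ C * Real.exp (c * (u + 1)) := by gcongr; exact hy.2.le
      _ = C * Real.exp c * Real.exp (c * u) := by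
          rw [mul_assoc, ← Real.exp_add]; ring_nf

/-- The unit-window average vanishes on `(-∞,-1]`. -/
lemma window_eq_zero_of_le (hK0 : ∀ x : ℝ, x < 0 → K x = 0) {u : ℝ} (hu : u ≤ -1) :
    ∫ y in Ioo (0 : ℝ) 1, K (u + y) = 0 := by
  apply setIntegral_eq_zero_of_forall_eq_zero
  intro y hy
  exact hK0 _ (by linarith [hy.2])

/-- Closed form `unitLaplace z = (e^{-iz} - 1)/(-iz)` for `z ≠ 0`. -/
lemma unitLaplace_eq (z : ℂ) (hz : z ≠ 0) :
    unitLaplace z = (Complex.exp (-(I * z)) - 1) / (-(I * z)) := by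
  have hc : -(I * z) ≠ 0 := neg_ne_zero.mpr (mul_ne_zero I_ne_zero hz)
  have h1 : ∫ y in (0 : ℝ)..1, Complex.exp (-(I * z) * (y : ℂ)) =
      (Complex.exp (-(I * z) * (1 : ℝ)) - Complex.exp (-(I * z) * (0 : ℝ))) / (-(I * z)) :=
    integral_exp_mul_complex hc
  rw [intervalIntegral.integral_of_le zero_le_one, integral_Ioc_eq_integral_Ioo] at h1
  rw [unitLaplace, h1]
  simp

/-- `unitLaplace` is holomorphic on the upper half-plane. -/
lemma differentiableOn_unitLaplace : DifferentiableOn ℂ unitLaplace {z : ℂ | 0 < z.im} := by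
  have h : DifferentiableOn ℂ (fun z : ℂ => (Complex.exp (-(I * z)) - 1) / (-(I * z)))
      {z : ℂ | 0 < z.im} := by
    apply DifferentiableOn.div
    · fun_prop
    · fun_prop
    · intro z hz
      have : z ≠ 0 := fun h => by simp [h] at hz
      exact neg_ne_zero.mpr (mul_ne_zero I_ne_zero this)
  refine h.congr ?_
  intro z hz
  have : z ≠ 0 := fun h => by simp [h] at hz
  exact unitLaplace_eq z this

/-- `unitLaplace i = e - 1 ≠ 0`. -/
lemma unitLaplace_I_ne_zero : unitLaplace I ≠ 0 := by
  rw [unitLaplace_eq I I_ne_zero]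
  have h1 : -(I * I) = (1 : ℂ) := by rw [I_mul_I, neg_neg]
  rw [h1, div_one, sub_ne_zero]
  have h2 : Complex.exp 1 = ((Real.exp 1 : ℝ) : ℂ) := by
    rw [Complex.ofReal_exp]; simp
  rw [h2]
  have h3 : (1 : ℝ) < Real.exp 1 := by
    have := Real.add_one_lt_exp (one_ne_zero (α := ℝ)); linarith
  exact_mod_cast h3.ne'

/-- Integrability of `u ↦ W(u) e^{izu}` on `ℝ` for `W ∈ L²` vanishing on `(-∞,-1]` and `Im z > 0`. -/
lemma integrable_laplaceIntegrand {W : ℝ → ℝ} (hW2 : MemLp W 2 volume)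
    (hW0 : ∀ u : ℝ, u ≤ -1 → W u = 0) {z : ℂ} (hz : 0 < z.im) :
    Integrable (fun u : ℝ => (W u : ℂ) * Complex.exp (I * z * (u : ℂ))) := by
  have hg : Integrable (fun u : ℝ => (Ioi (-1 : ℝ)).indicator
      (fun u => Real.exp (-(2 * z.im) * u)) u) :=
    (exp_neg_integrableOn_Ioi (-1) (by positivity)).integrable_indicator measurableSet_Ioi
  have hbound : Integrable (fun u : ℝ => W u ^ 2 +
      (Ioi (-1 : ℝ)).indicator (fun u => Real.exp (-(2 * z.im) * u)) u) :=
    hW2.integrable_sq.add hg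
  refine hbound.mono' ?_ (Eventually.of_forall fun u => ?_)
  · exact (Complex.continuous_ofReal.comp_aestronglyMeasurable hW2.1).mul
      (by fun_prop : Continuous fun u : ℝ => Complex.exp (I * z * (u : ℂ))).aestronglyMeasurable
  · rw [norm_mul, Complex.norm_real, norm_cexp_I_mul_mul_ofReal, Real.norm_eq_abs]
    by_cases hu : u ≤ -1
    · rw [hW0 u hu, abs_zero, zero_mul]
      exact add_nonneg (sq_nonneg _) (Set.indicator_nonneg (fun _ _ => (Real.exp_pos _).le) _)
    · have hu' : u ∈ Ioi (-1 : ℝ) := lt_of_not_ge hu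
      rw [indicator_of_mem hu']
      have h2 : Real.exp (-(2 * z.im) * u) = Real.exp (-(z.im * u)) ^ 2 := by
        rw [sq, ← Real.exp_add]; ring_nf
      rw [h2]
      nlinarith [sq_nonneg (|W u| - Real.exp (-(z.im * u))), sq_abs (W u),
        Real.exp_pos (-(z.im * u)), abs_nonneg (W u)]

/-- The Laplace transform `z ↦ ∫ W(u) e^{izu} du` of an `L²` function vanishing on `(-∞,-1]` is
holomorphic on `ℂ₊` (differentiation under the integral sign, dominated by `W² + h²`). -/
lemma differentiableOn_laplace_of_memLp {W : ℝ → ℝ} (hW2 : MemLp W 2 volume)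
    (hW0 : ∀ u : ℝ, u ≤ -1 → W u = 0) :
    DifferentiableOn ℂ (fun z : ℂ => ∫ u : ℝ, (W u : ℂ) * Complex.exp (I * z * (u : ℂ)))
      {z : ℂ | 0 < z.im} := by
  intro z₀ hz₀
  have hb : 0 < z₀.im := hz₀
  set b : ℝ := z₀.im with hb_def
  set s : Set ℂ := {z : ℂ | b / 2 < z.im ∧ z.im < 3 * b / 2} with hs_def
  have hs_open : IsOpen s :=
    (isOpen_lt continuous_const Complex.continuous_im).inter
      (isOpen_lt Complex.continuous_im continuous_const)
  have hz₀s : z₀ ∈ s := ⟨by show b / 2 < z₀.im; linarith, by show z₀.im < 3 * b / 2; linarith⟩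
  have hs : s ∈ 𝓝 z₀ := hs_open.mem_nhds hz₀s
  set F : ℂ → ℝ → ℂ := fun z u => (W u : ℂ) * Complex.exp (I * z * (u : ℂ)) with hF_def
  set F' : ℂ → ℝ → ℂ :=
    fun z u => (W u : ℂ) * (Complex.exp (I * z * (u : ℂ)) * (I * 1 * (u : ℂ))) with hF'_def
  set h₁ : ℝ → ℝ := (Ioo (-1 : ℝ) 0).indicator fun _ => Real.exp (3 * b / 2) with hh₁
  set h₂ : ℝ → ℝ := (Ioi (0 : ℝ)).indicator fun u => 4 / b * Real.exp (-(b / 4) * u) with hh₂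
  set bound : ℝ → ℝ := fun u => W u ^ 2 + (h₁ u ^ 2 + h₂ u ^ 2) with hbound_def
  have hmeas : ∀ z : ℂ, AEStronglyMeasurable (F z) volume := fun z =>
    (Complex.continuous_ofReal.comp_aestronglyMeasurable hW2.1).mul
      (by fun_prop : Continuous fun u : ℝ => Complex.exp (I * z * (u : ℂ))).aestronglyMeasurable
  have hmeas' : AEStronglyMeasurable (F' z₀) volume :=
    (Complex.continuous_ofReal.comp_aestronglyMeasurable hW2.1).mul
      (by fun_prop : Continuous fun u : ℝ =>
        Complex.exp (I * z₀ * (u : ℂ)) * (I * 1 * (u : ℂ))).aestronglyMeasurable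
  have hint : Integrable (F z₀) volume := integrable_laplaceIntegrand hW2 hW0 hb
  have h1int : Integrable (fun u => h₁ u ^ 2) volume := by
    have : (fun u => h₁ u ^ 2) = (Ioo (-1 : ℝ) 0).indicator (fun _ => Real.exp (3 * b / 2) ^ 2) := by
      funext u
      by_cases hu : u ∈ Ioo (-1 : ℝ) 0 <;> simp [hh₁, hu]
    rw [this]
    have hc : IntegrableOn (fun _ : ℝ => Real.exp (3 * b / 2) ^ 2) (Ioo (-1 : ℝ) 0) volume :=
      integrable_const _
    exact hc.integrable_indicator measurableSet_Ioo
  have h2int : Integrable (fun u => h₂ u ^ 2) volume := by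
    have : (fun u => h₂ u ^ 2) =
        (Ioi (0 : ℝ)).indicator (fun u => (4 / b) ^ 2 * Real.exp (-(b / 2) * u)) := by
      funext u
      by_cases hu : u ∈ Ioi (0 : ℝ)
      · simp only [hh₂, indicator_of_mem hu]
        rw [mul_pow, sq (Real.exp _), ← Real.exp_add]; ring_nf
      · simp [hh₂, hu]
    rw [this]
    have hc : IntegrableOn (fun u : ℝ => (4 / b) ^ 2 * Real.exp (-(b / 2) * u)) (Ioi (0 : ℝ))
        volume :=
      (exp_neg_integrableOn_Ioi 0 (by positivity : 0 < b / 2)).const_mul ((4 / b) ^ 2)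
    exact hc.integrable_indicator measurableSet_Ioi
  have hbound_int : Integrable bound volume := hW2.integrable_sq.add (h1int.add h2int)
  have hdiff : ∀ᵐ u ∂volume, ∀ z ∈ s, HasDerivAt (fun z => F z u) (F' z u) z :=
    Eventually.of_forall fun u z _ =>
      (((hasDerivAt_id' z).const_mul I).mul_const (u : ℂ)).cexp.const_mul (W u : ℂ)
  have hh₁nn : ∀ u, 0 ≤ h₁ u := fun u =>
    Set.indicator_nonneg (fun _ _ => (Real.exp_pos _).le) _
  have hh₂nn : ∀ u, 0 ≤ h₂ u := fun u =>
    Set.indicator_nonneg (fun _ _ => by positivity) _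
  have hbd : ∀ᵐ u ∂volume, ∀ z ∈ s, ‖F' z u‖ ≤ bound u := by
    refine Eventually.of_forall fun u z hz => ?_
    obtain ⟨hz1, hz2⟩ : b / 2 < z.im ∧ z.im < 3 * b / 2 := hz
    have hn : ‖F' z u‖ = |W u| * (Real.exp (-(z.im * u)) * |u|) := by
      simp [hF'_def, norm_cexp_I_mul_mul_ofReal]
    rw [hn]
    show |W u| * (Real.exp (-(z.im * u)) * |u|) ≤ W u ^ 2 + (h₁ u ^ 2 + h₂ u ^ 2)
    by_cases hu1 : u ≤ -1
    · rw [hW0 u hu1, abs_zero, zero_mul]; positivity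
    by_cases hu0 : u = 0
    · subst hu0; simp only [abs_zero, mul_zero]; positivity
    rcases lt_or_gt_of_ne hu0 with hneg | hpos
    · -- `-1 < u < 0`
      have hmem : u ∈ Ioo (-1 : ℝ) 0 := ⟨lt_of_not_ge hu1, hneg⟩
      have hh₁u : h₁ u = Real.exp (3 * b / 2) := by simp [hh₁, indicator_of_mem hmem]
      have he : Real.exp (-(z.im * u)) ≤ Real.exp (3 * b / 2) := by
        apply Real.exp_le_exp.mpr
        nlinarith [hmem.1, hmem.2, hz1, hz2]
      have hau : |u| ≤ 1 := by rw [abs_of_neg hneg]; linarith [hmem.1]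
      have hmid : Real.exp (-(z.im * u)) * |u| ≤ h₁ u := by
        rw [hh₁u]
        calc Real.exp (-(z.im * u)) * |u| ≤ Real.exp (3 * b / 2) * 1 := by
              gcongr
          _ = Real.exp (3 * b / 2) := mul_one _
      have : |W u| * (Real.exp (-(z.im * u)) * |u|) ≤ |W u| * h₁ u := by gcongr
      nlinarith [sq_nonneg (|W u| - h₁ u), sq_abs (W u), hh₁nn u, hh₂nn u, abs_nonneg (W u),
        sq_nonneg (h₂ u)]
    · -- `0 < u`
      have hmem : u ∈ Ioi (0 : ℝ) := hpos
      have hh₂u : h₂ u = 4 / b * Real.exp (-(b / 4) * u) := by simp [hh₂, indicator_of_mem hmem]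
      have he : Real.exp (-(z.im * u)) ≤ Real.exp (-(b / 2) * u) := by
        apply Real.exp_le_exp.mpr; nlinarith
      have hlin : b / 4 * u ≤ Real.exp (b / 4 * u) := by
        have := Real.add_one_le_exp (b / 4 * u); linarith
      have hmid : Real.exp (-(z.im * u)) * |u| ≤ h₂ u := by
        rw [hh₂u, abs_of_pos hpos]
        have hprod : Real.exp (b / 4 * u) * Real.exp (-(b / 2) * u) = Real.exp (-(b / 4) * u) := by
          rw [← Real.exp_add]; ring_nf
        calc Real.exp (-(z.im * u)) * u ≤ Real.exp (-(b / 2) * u) * u := by gcongr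
          _ = 4 / b * (b / 4 * u) * Real.exp (-(b / 2) * u) := by field_simp
          _ ≤ 4 / b * Real.exp (b / 4 * u) * Real.exp (-(b / 2) * u) := by gcongr
          _ = 4 / b * Real.exp (-(b / 4) * u) := by rw [mul_assoc, hprod]
      have : |W u| * (Real.exp (-(z.im * u)) * |u|) ≤ |W u| * h₂ u := by gcongr
      nlinarith [sq_nonneg (|W u| - h₂ u), sq_abs (W u), hh₁nn u, hh₂nn u, abs_nonneg (W u),
        sq_nonneg (h₁ u)]
  have hmain := hasDerivAt_integral_of_dominated_loc_of_deriv_le hs (Eventually.of_forall hmeas)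
    hint hmeas' hbd hbound_int hdiff
  exact hmain.2.differentiableAt.differentiableWithinAt

/-- Fubini: for `Im z > 1/2` the Laplace transform of the unit-window average of a continuous kernel
vanishing on `(-∞,0)` and `≪ e^{x/2}` factors as (Laplace transform of the kernel) × `unitLaplace`. -/
lemma laplace_window_eq (hKc : Continuous K) (hK0 : ∀ x : ℝ, x < 0 → K x = 0) {C c : ℝ}
    (hc : 0 ≤ c) (hC : ∀ x : ℝ, 0 ≤ x → |K x| ≤ C * Real.exp (c * x)) {z : ℂ} (hz : c < z.im) :
    ∫ u : ℝ, ((∫ y in Ioo (0 : ℝ) 1, K (u + y) : ℝ) : ℂ) * Complex.exp (I * z * (u : ℂ)) =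
      (∫ x in Ioi (0 : ℝ), (K x : ℂ) * Complex.exp (I * z * (x : ℂ))) * unitLaplace z := by
  have hC0 : 0 ≤ C := by
    have := hC 0 le_rfl
    simp at this
    exact (abs_nonneg _).trans this
  set b := z.im with hb_def
  set f : ℝ → ℝ → ℂ := fun u y => (K (u + y) : ℂ) * Complex.exp (I * z * (u : ℂ)) with hf_def
  have h1 : ∀ u : ℝ, ((∫ y in Ioo (0 : ℝ) 1, K (u + y) : ℝ) : ℂ) * Complex.exp (I * z * (u : ℂ)) =
      ∫ y in Ioo (0 : ℝ) 1, f u y := by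
    intro u
    simp only [hf_def]
    rw [← integral_complex_ofReal, ← integral_mul_const]
  simp_rw [h1]
  have hae : ∀ᵐ p : ℝ × ℝ ∂((volume : Measure ℝ).prod (volume.restrict (Ioo (0 : ℝ) 1))),
      p.2 ∈ Ioo (0 : ℝ) 1 := by
    have hμ : (volume : Measure ℝ).prod (volume.restrict (Ioo (0 : ℝ) 1)) =
        ((volume : Measure ℝ).prod volume).restrict (univ ×ˢ Ioo (0 : ℝ) 1) := by
      rw [← Measure.prod_restrict, Measure.restrict_univ]
    rw [hμ]
    filter_upwards [ae_restrict_mem (MeasurableSet.univ.prod measurableSet_Ioo)] with p hp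
    exact hp.2
  have hg₁ : Integrable (fun u : ℝ => (Ioi (-1 : ℝ)).indicator
      (fun u => C * Real.exp c * Real.exp (-(b - c) * u)) u) := by
    have hc' : IntegrableOn (fun u : ℝ => C * Real.exp c * Real.exp (-(b - c) * u))
        (Ioi (-1 : ℝ)) volume :=
      (exp_neg_integrableOn_Ioi (-1) (by linarith : 0 < b - c)).const_mul (C * Real.exp c)
    exact hc'.integrable_indicator measurableSet_Ioi
  have hprod : Integrable (fun p : ℝ × ℝ => (Ioi (-1 : ℝ)).indicator
      (fun u => C * Real.exp c * Real.exp (-(b - c) * u)) p.1 * (fun _ : ℝ => (1 : ℝ)) p.2)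
      ((volume : Measure ℝ).prod (volume.restrict (Ioo (0 : ℝ) 1))) :=
    hg₁.mul_prod (integrable_const (1 : ℝ))
  have hint : Integrable (Function.uncurry f)
      ((volume : Measure ℝ).prod (volume.restrict (Ioo (0 : ℝ) 1))) := by
    refine hprod.mono' ?_ ?_
    · exact (by fun_prop : Continuous fun p : ℝ × ℝ =>
        (K (p.1 + p.2) : ℂ) * Complex.exp (I * z * (p.1 : ℂ))).aestronglyMeasurable
    · filter_upwards [hae] with p hp
      rcases p with ⟨u, y⟩
      have hy : y ∈ Ioo (0 : ℝ) 1 := hp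
      simp only [Function.uncurry_apply_pair, hf_def, mul_one]
      rw [norm_mul, Complex.norm_real, norm_cexp_I_mul_mul_ofReal, Real.norm_eq_abs]
      by_cases hu : u ≤ -1
      · have : K (u + y) = 0 := hK0 _ (by linarith [hy.2])
        rw [this, abs_zero, zero_mul]
        exact Set.indicator_nonneg (fun _ _ => by positivity) _
      · rw [indicator_of_mem (show u ∈ Ioi (-1 : ℝ) from lt_of_not_ge hu)]
        have hK := abs_shift_le_of_expBound hK0 hc hC (u := u) hy
        calc |K (u + y)| * Real.exp (-(b * u))
            ≤ C * Real.exp c * Real.exp (c * u) * Real.exp (-(b * u)) := by gcongr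
          _ = C * Real.exp c * Real.exp (-(b - c) * u) := by
              rw [mul_assoc (C * Real.exp c), ← Real.exp_add]; ring_nf
  rw [integral_integral_swap hint]
  have hK0' : ∀ x : ℝ, x ∉ Ioi (0 : ℝ) → (K x : ℂ) * Complex.exp (I * z * (x : ℂ)) = 0 := by
    intro x hx
    have : K x = 0 := eq_zero_of_nonpos_of_vanishing hKc hK0 (not_lt.mp hx)
    simp [this]
  have hA : ∫ x : ℝ, (K x : ℂ) * Complex.exp (I * z * (x : ℂ)) =
      ∫ x in Ioi (0 : ℝ), (K x : ℂ) * Complex.exp (I * z * (x : ℂ)) :=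
    (setIntegral_eq_integral_of_forall_compl_eq_zero hK0').symm
  have h4 : ∀ y : ℝ, ∫ u : ℝ, f u y =
      (∫ x in Ioi (0 : ℝ), (K x : ℂ) * Complex.exp (I * z * (x : ℂ))) *
        Complex.exp (-(I * z) * (y : ℂ)) := by
    intro y
    set g : ℝ → ℂ := fun x => (K x : ℂ) * Complex.exp (I * z * (x : ℂ)) *
      Complex.exp (-(I * z) * (y : ℂ)) with hg_def
    have hfg : (fun u => f u y) = fun u => g (u + y) := by
      funext u
      have he : Complex.exp (I * z * ((u + y : ℝ) : ℂ)) * Complex.exp (-(I * z) * (y : ℂ)) =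
          Complex.exp (I * z * (u : ℂ)) := by
        rw [← Complex.exp_add]
        congr 1
        push_cast
        ring
      simp only [hf_def, hg_def]
      rw [mul_assoc (K (u + y) : ℂ), he]
    rw [hfg, integral_add_right_eq_self g y, hg_def, integral_mul_const, hA]
  simp_rw [h4]
  rw [integral_const_mul, unitLaplace]

end Summit.RiemannHypothesis.RiemannHypothesis.Theorems.SuzukiDoor

end
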